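import Literature.AnabelianGeometry.AbsoluteAnabelian.RelativeGrothendieckConjecture
import Literature.AnabelianGeometry.AbsoluteAnabelian.AbsTopIII.LinearSystems
import HarnessLib

/-!
# Schema closures (LABEL-CHECK refuters) for `AugmentedProfiniteGrp.HomOver.IsIso` (F-0258) and
# `AbsTopIII.ValuationEvaluationData.IsIso` (F-2434)

PROOF-ONLY companion (cell abc-iut, block F, seat abc-iut-f-052 gen 13; abc-iut-F-lit's LABEL-CHECK list
`plan/LF-REFUTED-WITHOUT-REFUTER.tsv`, 2026-08-27T06:06Z: «a REFUTED label should name a kernel `¬∀` of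
record»).  Both declarations are PARAMETRISED PREDICATES (schemata, plan header rule R1 (ii)/R5), typed in
`RelativeGrothendieckConjecture.lean` (S. Mochizuki, *Topics surrounding the anabelian geometry of hyperbolic
curves* (2003) [Tpcs], Thm 4.12 p. 44: "continuous group isomorphisms `Π_{X₁} ≅ Π_{X₂}` over `Γ_K`") and
`AbsTopIII/LinearSystems.lean` (S. Mochizuki, *Topics in Absolute Anabelian Geometry III* (2015)
[AbsTopIII], Prop 1.3 p. 30: isomorphism of the data (a) `K_X^×`, (b) `V_X = {ord_x}`, (c) `U_v`).  A
predicate's universal closure is not a fact; here it is FALSE, by closed kernel witnesses: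
* `HomOver.not_forall_isIso` — not every continuous homomorphism over `G` is bijective: on the split
  product `D × G ↠ G` (`D ∋ d ≠ 1`) the map `(x, g) ↦ (1, g)` lies over `G` and kills `(d, 1)`
  (`exists_not_isIso_prod`; closed instance `D = ℤˣ`, `G = 1`, `exists_not_isIso`).  Instance form of
  record that HOLDS: `HomOver.isIso_id` (`RelativeGCFunctoriality.lean`).
* `ValuationEvaluationData.not_forall_isIso` — not every pair `(φ, σ)` is an isomorphism of
  valuation-evaluation data: on `G = ℤ` (one index, `ord = id`, `U = ⊥`) inversion `φ = (·)⁻¹` reverses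
  `ord` (`exists_not_isIso`).  Instance forms of record: `IsIso.symm` etc. (`LinearSystemsProp13Proofs`).
HONEST FRAMING: statements about OUR typed schemata (refuted-as-typed-∀ ≠ refuted-in-print; the
instance forms the cone consumes are untouched); nothing here bears on [IUTchIII] Cor 3.12; typed ≠
proved; nothing here asserts abc proved or refuted.
-/

universe u

namespace Literature.AnabelianGeometry.AbsoluteAnabelian

/-! ### F-0258 `AugmentedProfiniteGrp.HomOver.IsIso` -/

namespace AugmentedProfiniteGrp.HomOver

/-- **Split-product witness.**  Over ANY base group `G`, for ANY profinite `D` with an element `d ≠ 1`: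
on the split extension `Π := D × G ↠ G` the homomorphism `(x, g) ↦ (1, g)` is over `G` but NOT
bijective (it identifies `(d, 1)` and `(1, 1)`), so "isomorphism over `Γ_K`" ([Tpcs] Thm 4.12 p. 44)
is a genuine condition. [cite: MochizukiTopics2003, Thm 4.12 p.44] -/
theorem exists_not_isIso_prod (G D : ProfiniteGrp.{u}) (d : D) (hd : d ≠ 1) :
    ∃ (P : AugmentedProfiniteGrp G) (ψ : HomOver P P), ¬ ψ.IsIso := by
  let P : AugmentedProfiniteGrp G :=
    { arith := ProfiniteGrp.of (D × G)
      aug := ContinuousMonoidHom.snd D G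
      aug_surjective := fun g => ⟨(1, g), rfl⟩ }
  let ψ : HomOver P P :=
    ⟨(ContinuousMonoidHom.inr D G).comp (ContinuousMonoidHom.snd D G), fun _ => rfl⟩
  refine ⟨P, ψ, fun h => hd ?_⟩
  have h1 : ψ.toHom ((d, 1) : D × G) = ψ.toHom ((1, 1) : D × G) := rfl
  exact (Prod.mk_inj.mp (h.1 h1)).1

/-- Closed instance (universe `0`): base group trivial, `D = ℤˣ = {±1}` (discrete), `d = -1`.
[cite: MochizukiTopics2003, Thm 4.12 p.44] -/
theorem exists_not_isIso :
    ∃ (G : ProfiniteGrp.{0}) (P : AugmentedProfiniteGrp G) (ψ : HomOver P P), ¬ ψ.IsIso :=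
  ⟨ProfiniteGrp.ofFiniteGrp (FiniteGrp.of PUnit.{1}),
    exists_not_isIso_prod _ (ProfiniteGrp.ofFiniteGrp (FiniteGrp.of ℤˣ)) (-1 : ℤˣ)
      fun h => absurd h (show (-1 : ℤˣ) ≠ 1 by decide)⟩

/-- **F-0258, universal closure REFUTED** (kernel `¬∀` of record for the LABEL-CHECK list): it is false
that every continuous homomorphism over `G` between augmented profinite groups is an isomorphism.  Schema
row — the instance the cone consumes ("`Π_{X₁} ≅ Π_{X₂}` over `Γ_K`" for hyperbolic curves) is [Tpcs]
Thm 4.12's conclusion, a NAMED FACT elsewhere; `isIso_id` is the instance form that holds.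
[cite: MochizukiTopics2003, Thm 4.12 p.44] -/
theorem not_forall_isIso :
    ¬ ∀ (G : ProfiniteGrp.{0}) (A B : AugmentedProfiniteGrp G) (φ : HomOver A B),
        Literature.AnabelianGeometry.AbsoluteAnabelian.AugmentedProfiniteGrp.HomOver.IsIso φ := by
  intro h
  obtain ⟨G, P, ψ, hne⟩ := exists_not_isIso
  exact hne (h G P P ψ)

end AugmentedProfiniteGrp.HomOver

/-! ### F-2434 `AbsTopIII.ValuationEvaluationData.IsIso` -/

namespace AbsTopIII.ValuationEvaluationData

/-- **Inversion witness.**  On the valuation-evaluation data `G = ℤ` (written multiplicatively), one index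
with `ord = id` and `U = ⊥`, the pair `(φ, σ) = (inversion, id)` is NOT an isomorphism of data in the sense
of [AbsTopIII] Prop 1.3 (it reverses `ord`: `ord (φ 1) = -1 ≠ 1`). [cite: MochizukiAbsTopIII2015, Prop 1.3 p.30] -/
theorem exists_not_isIso :
    ∃ (T : ValuationEvaluationData.{0}) (φ : T.G ≃* T.G) (σ : T.I ≃ T.I), ¬ T.IsIso T φ σ := by
  let T : ValuationEvaluationData.{0} :=
    { G := Multiplicative ℤ
      I := PUnit
      ord := fun _ g => Multiplicative.toAdd g
      U := fun _ => ⊥ }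
  refine ⟨T, MulEquiv.inv (Multiplicative ℤ), Equiv.refl _, fun h => ?_⟩
  have h1 := h.ord_comp PUnit.unit (Multiplicative.ofAdd (1 : ℤ))
  change Multiplicative.toAdd ((Multiplicative.ofAdd (1 : ℤ))⁻¹) =
    Multiplicative.toAdd (Multiplicative.ofAdd (1 : ℤ)) at h1
  rw [toAdd_inv, toAdd_ofAdd] at h1
  omega

/-- **F-2434, universal closure REFUTED** (kernel `¬∀` of record for the LABEL-CHECK list): it is false
that every pair `(φ, σ)` between valuation-evaluation data is an isomorphism of data.  Schema row — the
structure `IsIso` is the HYPOTHESIS shape of [AbsTopIII] Prop 1.3's functoriality clause; its laws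
(`IsIso.symm`, …, `LinearSystemsProp13Proofs.lean`) are the instance forms that hold.
[cite: MochizukiAbsTopIII2015, Prop 1.3 p.30] -/
theorem not_forall_isIso :
    ¬ ∀ (T T' : ValuationEvaluationData.{0}) (φ : T.G ≃* T'.G) (σ : T.I ≃ T'.I),
        Literature.AnabelianGeometry.AbsoluteAnabelian.AbsTopIII.ValuationEvaluationData.IsIso T T' φ σ := by
  intro h
  obtain ⟨T, φ, σ, hne⟩ := exists_not_isIso
  exact hne (h T T φ σ)

end AbsTopIII.ValuationEvaluationData

end Literature.AnabelianGeometry.AbsoluteAnabelian
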